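import Summits.QuantumFields.BalabanUV.Beta.GAN24.AliasStripSymbolsSum
import Summits.QuantumFields.BalabanUV.Beta.GAN24.StripAliasBounds
import Literature.MathematicalPhysics.QuantumFieldTheory.Balaban1983to89.B5Hk163Rate

/-!
# `BalabanUV.Beta.GAN24.ArrowOuterShiftWeights` — binder row G-an2-4 / (CONV-C), road P1-fibre, p1 row **P1-L10** `FibreStrip` ((I3′), the strip half of the
# K-slot), leaf-16's cut (M4) `L10-CUT-M4.md` row **F6 `ArrowOuterShift`** (OUTER LIPSCHITZ), PART 3: THE WEIGHT HALF — the box weights `s_κ(m), S(m), s♭, S♭, χ̂`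
# of T00 move by `O(η) × (their real-zone sinWt-majorant)` under the imaginary shift `|Im p| ≤ η ≤ 1` at a real anchor, for EVERY alias, uniformly in `N`

NOT IN PRINT; OUR PROOF ATTEMPT.  HONEST FRAMING (cell contract, verbatim): «discharging `BetaPertH` makes Bałaban's UV stability UNCONDITIONAL — a real
constructive-QFT result; it is NOT the continuum limit and NOT the Clay problem.»  HONEST DEPENDENCY (verbatim): «continuum YM on T⁴ ⇐ BetaPertH ∧ nine spine
estimates (0/9 proved); BetaPertH ⇐ (D1) ∧ (D4) ∧ CAP+tail; G-an2-4 gates asym, D1 and NE2/3/4.»  [folklore] bookkeeping BY NAME over leaf-19-g4's F2 part 3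
`AliasStripSymbolsSum` (`norm_gsum_sq_le`, `norm_gsum_add_sub_sq_le`), leaf-18's Y10g\* `StripAliasBounds` (`kAl_eq_ofRealVec_add`, `kAl_re_im`), L06
`AliasWeights(+Sum)` (`sinWt`, `norm_geomExp_sq_le`, `sinWt_kfine_le_wMaj`, `sum_prod_wMaj_le`) and the Literature product telescope
`B5Hk163Rate.norm_prod_sub_prod_le_maj`; no cited fact, no wall binder, no `def`, no unit sequence touched (ref2 c2/c3).  NOT summit progress; discharges nothing of
the K-slot `GAN24.CombesThomas.ConvCK 3 Lc` (weight input of F6 ⊂ F7 = (U1)).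

## Setting and what is proved (T00 `AliasObjects` currency `sAl/SAl/sbAl/SbAl/chiAl`; every `D`, every `N ≥ 1`, EVERY alias `m`)
Real anchor `q`, strip point `p` over it (`reVec p = q`, `|Im p_i| ≤ η`, `0 ≤ η ≤ 1`); `w_i := sinWt N (kfine N q m i)` the one-coordinate weight of L06.
* §1 one factor: `‖s_i(m)(q)‖ ≤ N√w_i`, `‖s_i(m)(p)‖ ≤ 8N√w_i` (`e² ≤ 8`), `‖s_i(m)(p) − s_i(m)(q)‖ ≤ 56·η·N√w_i`; flat twins (`sinWt` is even);
* §2 products (telescope with majorants `8N√w_i`, `ε_i = 7η`): `‖S(m)(p) − S(m)(q)‖ ≤ 7Dη·8^D N^D Π√w_i`, sizes `‖S(m)(q)‖ ≤ N^DΠ√w_i`, `‖S(m)(p)‖ ≤ 8^DN^DΠ√w_i`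
  (flat twins), `‖χ̂(p) − χ̂(q)‖ ≤ 7Dη·8^D Π√w_i`, and the two border products
  `‖S s_κ(p) − S s_κ(q)‖ ≤ 7(D+1)η·8^{D+1}N^{D+1}Π√w_i·√w_κ`, `‖χ̂ s♭_κ(p) − χ̂ s♭_κ(q)‖ ≤ 7(D+1)η·8^{D+1}N·Π√w_i·√w_κ`;
* §3 the alias sum `Σ_m Π_i w_i(m) ≤ 5^D` on `q ∈ [−π, π]^D` (zero alias `≤ 1` + L06 `sum_prod_wMaj_le`).
PART 4 (`ArrowOuterShift`) multiplies by the outer scalings of F1c (`(N²/r_m²)(r₀²/N³)`, `(N³/r_m³)(r₀³/N³)`, `(r₀/N^{D+1})(N/r_m)`, `N^{−(D+1)}` — every `N`-power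
cancels EXACTLY) and sums the squares over aliases into the border Frobenius bounds of F1b.
Unit `b2b-balaban-gan24-formalise-leaf-10` (G-an2-4 formalisation swarm, leaf prover 10, gen 5), 2026-08-20.  Value = bookkeeping toward (I3′), NOT summit progress.
-/

noncomputable section

open Complex Finset
open scoped BigOperators Real
open Literature.Probability.LatticeModels (TorusSite)
open Literature.MathematicalPhysics.QuantumFieldTheory.Balaban1983to89 (B5Hk163Rate.norm_prod_sub_prod_le_maj)
open Literature.MathematicalPhysics.QuantumFieldTheory.Balaban1983to89.B4Strip (ofRealVec reVec)

namespace Summit.QuantumFields.BalabanUV.Beta.GAN24.ArrowOuterShiftWeights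

open FibreSymbols (gsum)
open AliasWeights (sinWt sinWt_pos sinWt_le_one kfine norm_geomExp_sq_le sinWt_kfine_le_wMaj wMaj wMaj_nonneg)
open AliasWeightsSum (sum_prod_wMaj_le)
open AliasObjects (kAl gs sAl SAl sbAl SbAl chiAl)
open StripAliasBounds (kAl_eq_ofRealVec_add kAl_re_im)
open AliasStripSymbolsSum (norm_gsum_sq_le norm_gsum_add_sub_sq_le)

variable {D : ℕ} {N : ℕ} [NeZero N]

/-! ## §0 Scalar bricks -/

/-- [folklore] `√(e⁴·x) ≤ 8·√x` (`e² ≤ 8`; the named scalar fact lives in the Literature sieve files and is not restated here). -/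
theorem sqrt_exp_four_mul_le (x : ℝ) : Real.sqrt (Real.exp 4 * x) ≤ 8 * Real.sqrt x := by
  have he : Real.exp 2 ≤ 8 := by
    have h := Real.exp_one_lt_d9
    have h0 := Real.exp_pos 1
    rw [show (2 : ℝ) = 1 + 1 by norm_num, Real.exp_add]
    nlinarith
  rw [Real.sqrt_mul (Real.exp_pos 4).le, show (4 : ℝ) = 2 + 2 by norm_num, Real.exp_add, Real.sqrt_mul_self (Real.exp_pos 2).le]
  exact mul_le_mul_of_nonneg_right he (Real.sqrt_nonneg _)

/-- [folklore] T00's geometric sum IS `FibreSymbols.gsum` (same finite sum). -/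
theorem gs_eq_gsum (z : ℂ) (n : ℕ) : gs z n = gsum z n := rfl

/-- [folklore] From a squared bound to a bound: `a² ≤ c²·x`, `0 ≤ a, c` ⇒ `a ≤ c·√x`. -/
theorem le_mul_sqrt_of_sq_le {a c x : ℝ} (ha : 0 ≤ a) (hc : 0 ≤ c) (h : a ^ 2 ≤ c ^ 2 * x) : a ≤ c * Real.sqrt x := by
  have hx : 0 ≤ c ^ 2 * x := le_trans (sq_nonneg a) h
  calc a = Real.sqrt (a ^ 2) := (Real.sqrt_sq ha).symm
    _ ≤ Real.sqrt (c ^ 2 * x) := Real.sqrt_le_sqrt h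
    _ = c * Real.sqrt x := by rw [Real.sqrt_mul (sq_nonneg c), Real.sqrt_sq hc]

variable {q : Fin D → ℝ} {p : Fin D → ℂ} {η : ℝ}

/-! ## §1 One factor: `s_i(m)` and its flat twin on the strip -/

/-- [folklore] The fine momentum over a strip point: `k_m(p)_i = ↑(kfine N q m i) + i·(Im p_i/N)` (`reVec p = q`; leaf-18's decomposition). -/
theorem kAl_eq (hpq : reVec p = q) (m : TorusSite D N) (i : Fin D) :
    kAl N p m i = ((kfine N q m i : ℝ) : ℂ) + I * ((((p i).im / N : ℝ)) : ℂ) := by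
  rw [StripAliasBounds.kAl_eq_kfine_add, hpq]

/-- [folklore] The shift `h_i = i·Im p_i/N` has `N·‖h_i‖ ≤ η`. -/
theorem norm_shift_le (him : ∀ i, |(p i).im| ≤ η) (i : Fin D) : (N : ℝ) * ‖I * ((((p i).im / N : ℝ)) : ℂ)‖ ≤ η := by
  have hN : (0 : ℝ) < N := by exact_mod_cast Nat.pos_of_ne_zero (NeZero.ne N)
  rw [norm_mul, Complex.norm_I, one_mul, Complex.norm_real, Real.norm_eq_abs, abs_div, Nat.abs_cast, mul_div_cancel₀ _ hN.ne']
  exact him i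

/-- [folklore] **ANCHOR SIZE**: `‖s_i(m)(q)‖ ≤ N·√(sinWt N (kfine N q m i))` (L06 `norm_geomExp_sq_le`). -/
theorem norm_sAl_anchor_le (q : Fin D → ℝ) (m : TorusSite D N) (i : Fin D) :
    ‖sAl N (ofRealVec q) m i‖ ≤ N * Real.sqrt (sinWt N (kfine N q m i)) := by
  have h := norm_geomExp_sq_le (kfine N q m i) N
  refine le_mul_sqrt_of_sq_le (norm_nonneg _) (Nat.cast_nonneg N) ?_
  unfold sAl gs
  rw [ReadingWeightSums.kAl_ofRealVec]
  exact h

/-- [folklore] Flat twin: `‖s♭_i(m)(q)‖ ≤ N·√(sinWt …)` (`sinWt` is even). -/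
theorem norm_sbAl_anchor_le (q : Fin D → ℝ) (m : TorusSite D N) (i : Fin D) :
    ‖sbAl N (ofRealVec q) m i‖ ≤ N * Real.sqrt (sinWt N (kfine N q m i)) := by
  have h := norm_geomExp_sq_le (-kfine N q m i) N
  rw [ReadingWeightSums.sinWt_neg] at h
  refine le_mul_sqrt_of_sq_le (norm_nonneg _) (Nat.cast_nonneg N) ?_
  unfold sbAl gs
  rw [ReadingWeightSums.kAl_ofRealVec]
  push_cast at h ⊢
  exact h

/-- [folklore] **STRIP SIZE**: `‖s_i(m)(p)‖ ≤ 8N·√(sinWt …)` (`reVec p = q`, `|Im p_i| ≤ η ≤ 1`; F2 `norm_gsum_sq_le` with `ρ = 1`, `e² ≤ 8`). -/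
theorem norm_sAl_le (hpq : reVec p = q) (him : ∀ i, |(p i).im| ≤ η) (hη1 : η ≤ 1) (m : TorusSite D N) (i : Fin D) :
    ‖sAl N p m i‖ ≤ 8 * N * Real.sqrt (sinWt N (kfine N q m i)) := by
  have hre : (kAl N p m i).re = kfine N q m i := by rw [(kAl_re_im p m i).1, hpq]
  have him' : |(kAl N p m i).im| * N ≤ 1 := by
    rw [(kAl_re_im p m i).2, abs_div, Nat.abs_cast]
    have hN : (0 : ℝ) < N := by exact_mod_cast Nat.pos_of_ne_zero (NeZero.ne N)
    rw [div_mul_cancel₀ _ hN.ne']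
    exact (him i).trans hη1
  have h := norm_gsum_sq_le (z := kAl N p m i) (n := N) him'
  rw [hre, mul_one] at h
  have h2 : ‖sAl N p m i‖ ≤ Real.sqrt (Real.exp 4 * ((N : ℝ) ^ 2 * sinWt N (kfine N q m i))) := by
    unfold sAl; rw [gs_eq_gsum]; exact Real.le_sqrt_of_sq_le h
  calc ‖sAl N p m i‖ ≤ Real.sqrt (Real.exp 4 * ((N : ℝ) ^ 2 * sinWt N (kfine N q m i))) := h2
    _ ≤ 8 * Real.sqrt ((N : ℝ) ^ 2 * sinWt N (kfine N q m i)) := sqrt_exp_four_mul_le _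
    _ = 8 * N * Real.sqrt (sinWt N (kfine N q m i)) := by
        rw [Real.sqrt_mul (sq_nonneg _), Real.sqrt_sq (Nat.cast_nonneg N), mul_assoc]

/-- [folklore] Flat twin: `‖s♭_i(m)(p)‖ ≤ 8N·√(sinWt …)`. -/
theorem norm_sbAl_le (hpq : reVec p = q) (him : ∀ i, |(p i).im| ≤ η) (hη1 : η ≤ 1) (m : TorusSite D N) (i : Fin D) :
    ‖sbAl N p m i‖ ≤ 8 * N * Real.sqrt (sinWt N (kfine N q m i)) := by
  have hre : (-kAl N p m i).re = -kfine N q m i := by rw [Complex.neg_re, (kAl_re_im p m i).1, hpq]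
  have him' : |(-kAl N p m i).im| * N ≤ 1 := by
    rw [Complex.neg_im, abs_neg, (kAl_re_im p m i).2, abs_div, Nat.abs_cast]
    have hN : (0 : ℝ) < N := by exact_mod_cast Nat.pos_of_ne_zero (NeZero.ne N)
    rw [div_mul_cancel₀ _ hN.ne']
    exact (him i).trans hη1
  have h := norm_gsum_sq_le (z := -kAl N p m i) (n := N) him'
  rw [hre, ReadingWeightSums.sinWt_neg, mul_one] at h
  have h2 : ‖sbAl N p m i‖ ≤ Real.sqrt (Real.exp 4 * ((N : ℝ) ^ 2 * sinWt N (kfine N q m i))) := by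
    unfold sbAl; rw [gs_eq_gsum]; exact Real.le_sqrt_of_sq_le h
  calc ‖sbAl N p m i‖ ≤ Real.sqrt (Real.exp 4 * ((N : ℝ) ^ 2 * sinWt N (kfine N q m i))) := h2
    _ ≤ 8 * Real.sqrt ((N : ℝ) ^ 2 * sinWt N (kfine N q m i)) := sqrt_exp_four_mul_le _
    _ = 8 * N * Real.sqrt (sinWt N (kfine N q m i)) := by
        rw [Real.sqrt_mul (sq_nonneg _), Real.sqrt_sq (Nat.cast_nonneg N), mul_assoc]

/-- [folklore] **STRIP SHIFT**: `‖s_i(m)(p) − s_i(m)(q)‖ ≤ 56·η·N·√(sinWt …)` (F2 `norm_gsum_add_sub_sq_le`: `z` real, `N‖h‖ ≤ η ≤ 1`). -/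
theorem norm_sAl_sub_le (hpq : reVec p = q) (him : ∀ i, |(p i).im| ≤ η) (hη0 : 0 ≤ η) (hη1 : η ≤ 1) (m : TorusSite D N) (i : Fin D) :
    ‖sAl N p m i - sAl N (ofRealVec q) m i‖ ≤ 56 * η * N * Real.sqrt (sinWt N (kfine N q m i)) := by
  have hN : (0 : ℝ) < N := by exact_mod_cast Nat.pos_of_ne_zero (NeZero.ne N)
  set z : ℂ := ((kfine N q m i : ℝ) : ℂ) with hz
  set h : ℂ := I * ((((p i).im / N : ℝ)) : ℂ) with hh
  have hz_im : (N : ℝ) * |z.im| ≤ 1 := by rw [hz, Complex.ofReal_im, abs_zero, mul_zero]; exact zero_le_one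
  have hNh : (N : ℝ) * ‖h‖ ≤ η := norm_shift_le him i
  have hh1 : (N : ℝ) * ‖h‖ ≤ 1 := hNh.trans hη1
  have key := norm_gsum_add_sub_sq_le (z := z) (h := h) (n := N) hz_im hh1
  have hzre : z.re = kfine N q m i := by rw [hz, Complex.ofReal_re]
  rw [hzre] at key
  have e1 : sAl N p m i = gsum (z + h) N := by unfold sAl; rw [gs_eq_gsum, kAl_eq hpq]
  have e2 : sAl N (ofRealVec q) m i = gsum z N := by unfold sAl; rw [gs_eq_gsum, ReadingWeightSums.kAl_ofRealVec]
  rw [e1, e2]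
  have key' : ‖gsum (z + h) N - gsum z N‖ ^ 2 ≤ (56 * η * N) ^ 2 * sinWt N (kfine N q m i) := by
    refine key.trans ?_
    have hs : 0 ≤ sinWt N (kfine N q m i) := (sinWt_pos _ _).le
    have : ((N : ℝ) * ‖h‖) ^ 2 ≤ η ^ 2 := pow_le_pow_left₀ (by positivity) hNh 2
    nlinarith [sq_nonneg (N : ℝ), mul_nonneg (mul_nonneg (sq_nonneg (N:ℝ)) hs) (sub_nonneg.2 this)]
  exact le_mul_sqrt_of_sq_le (norm_nonneg _) (by positivity) key'

/-- [folklore] Flat twin: `‖s♭_i(m)(p) − s♭_i(m)(q)‖ ≤ 56·η·N·√(sinWt …)`. -/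
theorem norm_sbAl_sub_le (hpq : reVec p = q) (him : ∀ i, |(p i).im| ≤ η) (hη0 : 0 ≤ η) (hη1 : η ≤ 1) (m : TorusSite D N) (i : Fin D) :
    ‖sbAl N p m i - sbAl N (ofRealVec q) m i‖ ≤ 56 * η * N * Real.sqrt (sinWt N (kfine N q m i)) := by
  have hN : (0 : ℝ) < N := by exact_mod_cast Nat.pos_of_ne_zero (NeZero.ne N)
  set z : ℂ := -(((kfine N q m i : ℝ) : ℂ)) with hz
  set h : ℂ := -(I * ((((p i).im / N : ℝ)) : ℂ)) with hh
  have hz_im : (N : ℝ) * |z.im| ≤ 1 := by rw [hz, Complex.neg_im, Complex.ofReal_im, neg_zero, abs_zero, mul_zero]; exact zero_le_one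
  have hNh : (N : ℝ) * ‖h‖ ≤ η := by rw [hh, norm_neg]; exact norm_shift_le him i
  have hh1 : (N : ℝ) * ‖h‖ ≤ 1 := hNh.trans hη1
  have key := norm_gsum_add_sub_sq_le (z := z) (h := h) (n := N) hz_im hh1
  have hzre : z.re = -kfine N q m i := by rw [hz, Complex.neg_re, Complex.ofReal_re]
  rw [hzre, ReadingWeightSums.sinWt_neg] at key
  have e1 : sbAl N p m i = gsum (z + h) N := by
    unfold sbAl; rw [gs_eq_gsum, kAl_eq hpq, hz, hh, neg_add]
  have e2 : sbAl N (ofRealVec q) m i = gsum z N := by unfold sbAl; rw [gs_eq_gsum, ReadingWeightSums.kAl_ofRealVec]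
  rw [e1, e2]
  have key' : ‖gsum (z + h) N - gsum z N‖ ^ 2 ≤ (56 * η * N) ^ 2 * sinWt N (kfine N q m i) := by
    refine key.trans ?_
    have hs : 0 ≤ sinWt N (kfine N q m i) := (sinWt_pos _ _).le
    have : ((N : ℝ) * ‖h‖) ^ 2 ≤ η ^ 2 := pow_le_pow_left₀ (by positivity) hNh 2
    nlinarith [sq_nonneg (N : ℝ), mul_nonneg (mul_nonneg (sq_nonneg (N:ℝ)) hs) (sub_nonneg.2 this)]
  exact le_mul_sqrt_of_sq_le (norm_nonneg _) (by positivity) key'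

/-! ## §2 Products: `S(m)`, `S♭(m)`, `χ̂(m)` and the two border products -/

/-- [folklore] The common majorant of one factor, `8N√w_i`, is nonnegative. -/
theorem maj_nonneg (N : ℕ) (x : ℝ) : 0 ≤ 8 * (N : ℝ) * Real.sqrt (sinWt N x) := by positivity

/-- [folklore] **`S(m)` SHIFT**: `‖S(m)(p) − S(m)(q)‖ ≤ 7Dη · Π_i (8N√w_i)` (Literature telescope `B5Hk163Rate.norm_prod_sub_prod_le_maj` with majorants `8N√w_i`,
relative sizes `7η`: `56 = 7·8`). -/
theorem norm_SAl_sub_le (hpq : reVec p = q) (him : ∀ i, |(p i).im| ≤ η) (hη0 : 0 ≤ η) (hη1 : η ≤ 1) (m : TorusSite D N) :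
    ‖SAl N p m - SAl N (ofRealVec q) m‖ ≤ 7 * D * η * ∏ i, (8 * (N : ℝ) * Real.sqrt (sinWt N (kfine N q m i))) := by
  classical
  have h := B5Hk163Rate.norm_prod_sub_prod_le_maj (Finset.univ : Finset (Fin D)) (fun i => sAl N p m i) (fun i => sAl N (ofRealVec q) m i)
    (fun i => 8 * (N : ℝ) * Real.sqrt (sinWt N (kfine N q m i))) (fun _ => 7 * η)
    (fun i _ => maj_nonneg N _) (fun _ _ => by positivity)
    (fun i _ => norm_sAl_le hpq him hη1 m i)
    (fun i _ => (norm_sAl_anchor_le q m i).trans (by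
      have := maj_nonneg N (kfine N q m i)
      nlinarith [Real.sqrt_nonneg (sinWt N (kfine N q m i)), (Nat.cast_nonneg N : (0:ℝ) ≤ N)]))
    (fun i _ => (norm_sAl_sub_le hpq him hη0 hη1 m i).trans (le_of_eq (by ring)))
  unfold SAl
  refine h.trans (le_of_eq ?_)
  rw [Finset.sum_const, Finset.card_univ, Fintype.card_fin, nsmul_eq_mul]
  ring

/-- [folklore] Flat twin: `‖S♭(m)(p) − S♭(m)(q)‖ ≤ 7Dη · Π_i (8N√w_i)`. -/
theorem norm_SbAl_sub_le (hpq : reVec p = q) (him : ∀ i, |(p i).im| ≤ η) (hη0 : 0 ≤ η) (hη1 : η ≤ 1) (m : TorusSite D N) :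
    ‖SbAl N p m - SbAl N (ofRealVec q) m‖ ≤ 7 * D * η * ∏ i, (8 * (N : ℝ) * Real.sqrt (sinWt N (kfine N q m i))) := by
  classical
  have h := B5Hk163Rate.norm_prod_sub_prod_le_maj (Finset.univ : Finset (Fin D)) (fun i => sbAl N p m i) (fun i => sbAl N (ofRealVec q) m i)
    (fun i => 8 * (N : ℝ) * Real.sqrt (sinWt N (kfine N q m i))) (fun _ => 7 * η)
    (fun i _ => maj_nonneg N _) (fun _ _ => by positivity)
    (fun i _ => norm_sbAl_le hpq him hη1 m i)
    (fun i _ => (norm_sbAl_anchor_le q m i).trans (by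
      have := maj_nonneg N (kfine N q m i)
      nlinarith [Real.sqrt_nonneg (sinWt N (kfine N q m i)), (Nat.cast_nonneg N : (0:ℝ) ≤ N)]))
    (fun i _ => (norm_sbAl_sub_le hpq him hη0 hη1 m i).trans (le_of_eq (by ring)))
  unfold SbAl
  refine h.trans (le_of_eq ?_)
  rw [Finset.sum_const, Finset.card_univ, Fintype.card_fin, nsmul_eq_mul]
  ring

/-- [folklore] Anchor size: `‖S(m)(q)‖ ≤ Π_i (N√w_i)`. -/
theorem norm_SAl_anchor_le (q : Fin D → ℝ) (m : TorusSite D N) :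
    ‖SAl N (ofRealVec q) m‖ ≤ ∏ i, ((N : ℝ) * Real.sqrt (sinWt N (kfine N q m i))) := by
  unfold SAl
  rw [norm_prod]
  exact Finset.prod_le_prod (fun i _ => norm_nonneg _) fun i _ => norm_sAl_anchor_le q m i

/-- [folklore] Flat anchor size: `‖S♭(m)(q)‖ ≤ Π_i (N√w_i)`. -/
theorem norm_SbAl_anchor_le (q : Fin D → ℝ) (m : TorusSite D N) :
    ‖SbAl N (ofRealVec q) m‖ ≤ ∏ i, ((N : ℝ) * Real.sqrt (sinWt N (kfine N q m i))) := by
  unfold SbAl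
  rw [norm_prod]
  exact Finset.prod_le_prod (fun i _ => norm_nonneg _) fun i _ => norm_sbAl_anchor_le q m i

/-- [folklore] Strip size: `‖S(m)(p)‖ ≤ Π_i (8N√w_i)`. -/
theorem norm_SAl_le (hpq : reVec p = q) (him : ∀ i, |(p i).im| ≤ η) (hη1 : η ≤ 1) (m : TorusSite D N) :
    ‖SAl N p m‖ ≤ ∏ i, (8 * (N : ℝ) * Real.sqrt (sinWt N (kfine N q m i))) := by
  unfold SAl
  rw [norm_prod]
  exact Finset.prod_le_prod (fun i _ => norm_nonneg _) fun i _ => norm_sAl_le hpq him hη1 m i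

/-- [folklore] Flat strip size: `‖S♭(m)(p)‖ ≤ Π_i (8N√w_i)`. -/
theorem norm_SbAl_le (hpq : reVec p = q) (him : ∀ i, |(p i).im| ≤ η) (hη1 : η ≤ 1) (m : TorusSite D N) :
    ‖SbAl N p m‖ ≤ ∏ i, (8 * (N : ℝ) * Real.sqrt (sinWt N (kfine N q m i))) := by
  unfold SbAl
  rw [norm_prod]
  exact Finset.prod_le_prod (fun i _ => norm_nonneg _) fun i _ => norm_sbAl_le hpq him hη1 m i

omit [NeZero N] in
/-- [folklore] `Π_i (N√w_i) ≤ Π_i (8N√w_i)`. -/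
theorem prod_anchor_le_maj (q : Fin D → ℝ) (m : TorusSite D N) :
    ∏ i, ((N : ℝ) * Real.sqrt (sinWt N (kfine N q m i))) ≤ ∏ i, (8 * (N : ℝ) * Real.sqrt (sinWt N (kfine N q m i))) :=
  Finset.prod_le_prod (fun i _ => by positivity) fun i _ => by
    have := Real.sqrt_nonneg (sinWt N (kfine N q m i))
    nlinarith [(Nat.cast_nonneg N : (0:ℝ) ≤ N)]

/-- [folklore] The elementary product-difference bound with majorants: `‖x' − x‖ ≤ δ₁`, `‖y'‖ ≤ W`, `‖x‖ ≤ P`, `‖y' − y‖ ≤ δ₂` ⇒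
`‖x'y' − xy‖ ≤ δ₁·W + P·δ₂`. -/
theorem norm_mul_sub_mul_le_of_le {x y x' y' : ℂ} {P W δ₁ δ₂ : ℝ} (hP : 0 ≤ P) (h1 : ‖x' - x‖ ≤ δ₁) (h2 : ‖y'‖ ≤ W) (h3 : ‖x‖ ≤ P)
    (h4 : ‖y' - y‖ ≤ δ₂) : ‖x' * y' - x * y‖ ≤ δ₁ * W + P * δ₂ := by
  have h : x' * y' - x * y = (x' - x) * y' + x * (y' - y) := by ring
  rw [h]
  refine (norm_add_le _ _).trans ?_
  rw [norm_mul, norm_mul]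
  exact add_le_add (mul_le_mul h1 h2 (norm_nonneg _) ((norm_nonneg _).trans h1)) (mul_le_mul h3 h4 (norm_nonneg _) hP)

/-- [folklore] **THE Q-ROW BORDER PRODUCT**: `‖S s_κ(p) − S s_κ(q)‖ ≤ 7(D+1)η · Π_i(8N√w_i) · (8N√w_κ)`. -/
theorem norm_SAl_sAl_sub_le (hpq : reVec p = q) (him : ∀ i, |(p i).im| ≤ η) (hη0 : 0 ≤ η) (hη1 : η ≤ 1) (m : TorusSite D N) (κ : Fin D) :
    ‖SAl N p m * sAl N p m κ - SAl N (ofRealVec q) m * sAl N (ofRealVec q) m κ‖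
      ≤ 7 * (D + 1) * η * (∏ i, (8 * (N : ℝ) * Real.sqrt (sinWt N (kfine N q m i)))) * (8 * (N : ℝ) * Real.sqrt (sinWt N (kfine N q m κ))) := by
  have hP0 : 0 ≤ ∏ i, (8 * (N : ℝ) * Real.sqrt (sinWt N (kfine N q m i))) := Finset.prod_nonneg fun i _ => maj_nonneg N _
  have h := norm_mul_sub_mul_le_of_le hP0 (norm_SAl_sub_le hpq him hη0 hη1 m) (norm_sAl_le hpq him hη1 m κ)
    ((norm_SAl_anchor_le q m).trans (prod_anchor_le_maj q m)) (norm_sAl_sub_le hpq him hη0 hη1 m κ)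
  refine h.trans (le_of_eq ?_)
  ring

/-- [folklore] **THE EL-COLUMN BORDER PRODUCT**: `‖χ̂ s♭_κ(p) − χ̂ s♭_κ(q)‖ ≤ 7(D+1)η · Π_i(8N√w_i) · (8N√w_κ) / N^D` (`χ̂ = S♭/N^D`). -/
theorem norm_chiAl_sbAl_sub_le (hpq : reVec p = q) (him : ∀ i, |(p i).im| ≤ η) (hη0 : 0 ≤ η) (hη1 : η ≤ 1) (m : TorusSite D N) (κ : Fin D) :
    ‖chiAl N p m * sbAl N p m κ - chiAl N (ofRealVec q) m * sbAl N (ofRealVec q) m κ‖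
      ≤ 7 * (D + 1) * η * (∏ i, (8 * (N : ℝ) * Real.sqrt (sinWt N (kfine N q m i)))) * (8 * (N : ℝ) * Real.sqrt (sinWt N (kfine N q m κ)))
          / (N : ℝ) ^ D := by
  have hP0 : 0 ≤ ∏ i, (8 * (N : ℝ) * Real.sqrt (sinWt N (kfine N q m i))) := Finset.prod_nonneg fun i _ => maj_nonneg N _
  have h := norm_mul_sub_mul_le_of_le hP0 (norm_SbAl_sub_le hpq him hη0 hη1 m) (norm_sbAl_le hpq him hη1 m κ)
    ((norm_SbAl_anchor_le q m).trans (prod_anchor_le_maj q m)) (norm_sbAl_sub_le hpq him hη0 hη1 m κ)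
  have e : chiAl N p m * sbAl N p m κ - chiAl N (ofRealVec q) m * sbAl N (ofRealVec q) m κ
      = (SbAl N p m * sbAl N p m κ - SbAl N (ofRealVec q) m * sbAl N (ofRealVec q) m κ) / (N : ℂ) ^ D := by
    unfold chiAl; ring
  rw [e, norm_div, norm_pow, Complex.norm_natCast]
  refine div_le_div_of_nonneg_right (h.trans (le_of_eq ?_)) (by positivity)
  ring

/-- [folklore] **`χ̂(m)` SHIFT**: `‖χ̂(m)(p) − χ̂(m)(q)‖ ≤ 7Dη · Π_i(8N√w_i) / N^D`. -/
theorem norm_chiAl_sub_le (hpq : reVec p = q) (him : ∀ i, |(p i).im| ≤ η) (hη0 : 0 ≤ η) (hη1 : η ≤ 1) (m : TorusSite D N) :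
    ‖chiAl N p m - chiAl N (ofRealVec q) m‖ ≤ 7 * D * η * (∏ i, (8 * (N : ℝ) * Real.sqrt (sinWt N (kfine N q m i)))) / (N : ℝ) ^ D := by
  have e : chiAl N p m - chiAl N (ofRealVec q) m = (SbAl N p m - SbAl N (ofRealVec q) m) / (N : ℂ) ^ D := by unfold chiAl; ring
  rw [e, norm_div, norm_pow, Complex.norm_natCast]
  exact div_le_div_of_nonneg_right (norm_SbAl_sub_le hpq him hη0 hη1 m) (by positivity)

omit [NeZero N] in
/-- [folklore] The square of the product majorant: `(Π_i 8N√w_i)² = Π_i (64N²·w_i)`. -/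
theorem prod_maj_sq (q : Fin D → ℝ) (m : TorusSite D N) :
    (∏ i, (8 * (N : ℝ) * Real.sqrt (sinWt N (kfine N q m i)))) ^ 2 = ∏ i, (64 * (N : ℝ) ^ 2 * sinWt N (kfine N q m i)) := by
  rw [← Finset.prod_pow]
  refine Finset.prod_congr rfl fun i _ => ?_
  rw [mul_pow, mul_pow, Real.sq_sqrt (sinWt_pos _ _).le]; ring

/-- [folklore] The square of one majorant: `(8N√w)² = 64N²·w`. -/
theorem maj_sq (N : ℕ) (x : ℝ) : (8 * (N : ℝ) * Real.sqrt (sinWt N x)) ^ 2 = 64 * (N : ℝ) ^ 2 * sinWt N x := by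
  rw [mul_pow, mul_pow, Real.sq_sqrt (sinWt_pos _ _).le]; ring

omit [NeZero N] in
/-- [folklore] `Π_i (64N²·w_i) = (64N²)^D · Π_i w_i`. -/
theorem prod_const_mul_sinWt (q : Fin D → ℝ) (m : TorusSite D N) :
    ∏ i, (64 * (N : ℝ) ^ 2 * sinWt N (kfine N q m i)) = (64 * (N : ℝ) ^ 2) ^ D * ∏ i, sinWt N (kfine N q m i) := by
  rw [Finset.prod_mul_distrib, Finset.prod_const, Finset.card_univ, Fintype.card_fin]

/-! ## §3 The alias sum of the weight products -/

/-- [folklore] **`Σ_m Π_i w_i(m) ≤ 5^D`** on the Brillouin zone (`m = 0`: each `w_i ≤ 1`; `m ≠ 0`: `w_i ≤ wMaj` (L06 `sinWt_kfine_le_wMaj`) and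
`Σ_{m≠0} Π wMaj ≤ 5^D − 1` (L06 `sum_prod_wMaj_le`)). -/
theorem sum_prod_sinWt_le (hq : ∀ i, |q i| ≤ π) : ∑ m : TorusSite D N, ∏ i, sinWt N (kfine N q m i) ≤ (5 : ℝ) ^ D := by
  classical
  rw [← Finset.add_sum_erase _ _ (Finset.mem_univ (0 : TorusSite D N))]
  have h0 : ∏ i, sinWt N (kfine N q (0 : TorusSite D N) i) ≤ 1 :=
    Finset.prod_le_one (fun i _ => (sinWt_pos _ _).le) fun i _ => sinWt_le_one _ _
  have hrest : ∑ m ∈ (Finset.univ : Finset (TorusSite D N)).erase 0, ∏ i, sinWt N (kfine N q m i) ≤ (5 : ℝ) ^ D - 1 :=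
    (Finset.sum_le_sum fun m _ => Finset.prod_le_prod (fun i _ => (sinWt_pos _ _).le) fun i _ => sinWt_kfine_le_wMaj hq m i).trans
      (sum_prod_wMaj_le N)
  linarith

/-- [folklore] `Σ_m (Π_i w_i(m))·w_κ(m) ≤ 5^D` (drop `w_κ ≤ 1`). -/
theorem sum_prod_sinWt_mul_le (hq : ∀ i, |q i| ≤ π) (κ : Fin D) :
    ∑ m : TorusSite D N, (∏ i, sinWt N (kfine N q m i)) * sinWt N (kfine N q m κ) ≤ (5 : ℝ) ^ D :=
  (Finset.sum_le_sum fun _ _ => mul_le_of_le_one_right (Finset.prod_nonneg fun _ _ => (sinWt_pos _ _).le) (sinWt_le_one _ _)).trans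
    (sum_prod_sinWt_le hq)

end Summit.QuantumFields.BalabanUV.Beta.GAN24.ArrowOuterShiftWeights

end
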